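import Summits.QuantumFields.BalabanUV.Beta.GAN24.WardRemainderTransportedLetter
import Summits.QuantumFields.BalabanUV.Beta.GAN24.WardRemainderRows
import Summits.QuantumFields.BalabanUV.Beta.GAN24.SlotMomentParity

/-!
# `BalabanUV.Beta.GAN24.WardRemainderEndThree` — binder row G-an2-4 ∕ (CONV-C), W-slot CT-W, route «WC-TL» ∕ (Q-R) «QR-LL» (RULING R-gan24p1-g25-1 «(Q-R) BY
# LAYER LETTERS»; R-gan24p1-g26-1∕-2∕-3 (exponent ledger, K-LL-4, N1-TAYLOR `θ = Lc^{−1∕2}`); R-gan24p1-g27-1 (the (S) row); design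
# `HOME/b2b-balaban-gan24-p1/gen25/QR-DESIGN-v0.md` §3): **THE ASSEMBLY «(Q-R) AT `d = 3`»** — the owner's END `WardRemainderRows.wLocStencil_unitS_of_unrolled`
# (p320499 ✓) with its hypothesis `hσ` DISCHARGED level by level through the unit-transport∕`push₃` junction (`WardRemainderTransportedLetter` §1): LEG-AGNOSTIC
# form displaying ONE layer bound `hLT` (§1–§2), and the ENVELOPE reading in which `hLT` is leaf-01 g64's (LT-3) END `LayerTransportBiLoc` (p324201 ✓) (§3); the
# (S) row's `hP1` from (INV) ∧ (M0) by the owner's `SlotMomentParity` (p323484 ✓) (§4)  (row owner `b2b-balaban-gan24-p1`, gen 28)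

NOT IN PRINT; OUR BOOKKEEPING ([folklore] assembly BY NAME; 0 cited facts, 0 `def`, 0 `def … : Prop`, 0 sorry).  HONEST FRAMING (cell contract, verbatim):
«discharging `BetaPertH` makes Bałaban's UV stability UNCONDITIONAL — a real constructive-QFT result; it is NOT the continuum limit and NOT the Clay problem.»
HONEST DEPENDENCY (verbatim): «continuum YM on T⁴ ⇐ BetaPertH ∧ nine spine estimates (0/9 proved); BetaPertH ⇐ (D1) ∧ (D4) ∧ CAP+tail; G-an2-4 gates asym,
D1 and NE2/3/4.»

WHAT.  §1 **`wLocStencil_unitS_of_layer`** (LEG-AGNOSTIC END, generic `d`, ratio `θ ∈ [0,1)`): for an in-block root `toSite rr`, level `n`, label `Y` — IF (REP)'s unrolled identity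
holds (`hunroll`, p2 PART 5 verbatim; level-0 term `hΦ0` of label-weighted size `C₀`) and, uniformly in `m < n` (`n = m + k + 1`, composite blocking `L = Lc^k`),
(LAY) the level-`m` sandwich letter's super-block partial sum in units `S_m = unitS_{m+1} (Σ_{w ∈ box L} σ m (L•Y + w))` is ff-valued with the slot-weighted profile
`hS` under the face weight `hω` of the super-block of `Y`, and (LT) THE LAYER BOUND `hLT`: for `k ≥ 1` the cubic push `L^{12} • push₃ T T T S_m` through the DRESSED chain
`T = legChain (respStepBmSeq (toSite rr) Lc) (m+1) (k−1)` is `BiLoc … U U (K·θ^k·e^{−η‖Y−U‖₁}) (κ∕4)` — THEN `BiLoc (unitS_n (Φ n Y) κ′ u) u u ((C₀ + (K +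
2(d+1)e^δ·Cs)·(1 − θ)⁻¹)·e^{−η‖Y−u‖₁}) (κ∕4)`, `η = min(κ∕2, δ∕2)`: the level-`n` Ward-locus remainder IN UNITS is bounded and LABEL-LOCALISED, UNIFORMLY IN `n`
(QR-DESIGN §0).  §2 **`…_of_layer_zero`** (the literal: `Φ 0 ≡ 0`, `C₀ = 0`).  §3 **`wLocStencil_unitS_three`** (`d = 3`, `θ = (√Lc)⁻¹`, ENVELOPE READING): `hLT` := leaf-01's (LT-3) END on the
dressed chain, so the displays are K-LL-4 (`hT0–hT2`, three envelopes of the dressed composite legs — HONEST: not expected pointwise for the literal, leaf-01 g63 R-5;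
the route of record R-gan24p1-g26-2∕-3 moves the dressing onto the letters and feeds §1's `hLT` instead), (LAY)∕(CE) (`hff, hS, hω, hQ, hZ, hTl, hTcard`), (S)
(`hM0 ∕ hP1`), (REP).  §4 **`firstMoments_of_slotInv`**: the `hP1` family from (INV) ∧ (M0) (`SlotMomentParity.moments_of_slotInv`, involution `u ↦ 2•y′ − e_k − u` in the
letter's slot direction `k`).  §5 `isFF_finset_sum_apply ∕ isFF_smul_sum_mmRead ∕ isFF_unitS_finset_sum`: the END's `hff` for p2's sandwich letters, by name.

Discharges NOTHING of (Q-R) ∕ (LT) ∕ (Q-L) ∕ (C) ∕ (S) ∕ «T2Shape» ∕ «T2Drift» ∕ (hW, hWall) by itself — (Q-R) at `d = 3` holds EXACTLY modulo the displayed rows; NEVER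
«G-an2-4 closed» as (CONV-C); NOT D1, NOT `BetaPertH`, NOT continuum, NOT Clay.  2026-08-22.
-/

noncomputable section

open Finset
open scoped BigOperators
open Literature.MathematicalPhysics.QuantumFieldTheory
open Literature.MathematicalPhysics.QuantumFieldTheory.Balaban1983to89
open Literature.MathematicalPhysics.QuantumFieldTheory.Balaban1983to89.Beta
open B12Sec2to5 (l1 l1_nonneg)
open B6BondElimination (unitVec)
open ExpKernelCalculus (MKer Site BiLoc Zl Zl_nonneg)
open OneStepResolventKernel (Fib)
open OneStepKernelFamily (KInvStep)
open LatticeForm (quo)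
open AffineAveraging (box toSite)
open StepJetData (biLoc_weaken)
open Summit.QuantumFields.BalabanUV.Beta.SpineRooted (e3OfK)
open Summit.QuantumFields.BalabanUV.Beta.AxialDressingRooted (coDressKBmAt)
open Summit.QuantumFields.BalabanUV.Beta.HessKerDressedUnits (unitS)
open Summit.QuantumFields.BalabanUV.Beta.GAN24.CombesThomas (sfStep smStep)
open BalabanStepJetsSucc (wE mmRead)
open Summit.QuantumFields.BalabanUV.Beta.GAN24.Push4 (IsFF isFF_mmRead)
open Summit.QuantumFields.BalabanUV.Beta.GAN24.SrecWilsonSector (isFF_smul isFF_unitS)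
open Summit.QuantumFields.BalabanUV.Beta.GAN24.Push4Iter (legChain)
open Summit.QuantumFields.BalabanUV.Beta.GAN24.Push3 (push₃)
open Summit.QuantumFields.BalabanUV.Beta.GAN24.RespStepBmDecompExact (respStepBmSeq)
open Summit.QuantumFields.BalabanUV.Beta.GAN24.SrecBornSector (unitStepMap)
open Summit.QuantumFields.BalabanUV.Beta.GAN24.AffineUnroll (transport transport_zero)
open Summit.QuantumFields.BalabanUV.Beta.GAN24.WardRemainderRows (wLocStencil_unitS_of_unrolled unitS_zero transport_unitStepMap_zero)
open Summit.QuantumFields.BalabanUV.Beta.GAN24.SlotMomentParity (moments_of_slotInv)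
open Summit.QuantumFields.BalabanUV.Beta.GAN24.WardRemainderTransportedLetter (transport_unitStepMap_eq_cubic_push₃ locStencil_of_profile biLoc_of_profile_one
  biLoc_cubic_push₃_dressed_three)

namespace Summit.QuantumFields.BalabanUV.Beta.GAN24.WardRemainderEndThree

variable {Lc : ℕ} [NeZero Lc]

/-! ## §1 THE END «(Q-R)», LEG-AGNOSTIC (generic `d`, ratio `θ`): the layer bound `hLT` displayed, `hσ` discharged level by level -/

/-- NOT IN PRINT; OUR BOOKKEEPING (the owner's END `WardRemainderRows.wLocStencil_unitS_of_unrolled` (p320499 ✓) at `θ = (√Lc)⁻¹`, `ω κ u := e^{−η‖Y−u‖₁}`; its `hσ`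
DISCHARGED level by level: `k+1 ≥ 1` transported levels = the (REP) unit transport rewritten as ONE cubic push through the dressed chain
(`WardRemainderTransportedLetter.transport_unitStepMap_eq_cubic_push₃`) and bounded by the displayed LAYER BOUND `hLT`; the untransported level `m = n−1` by the
letter's own profile (`…biLoc_of_profile_one`)).  **THE ASSEMBLY «(Q-R)», LEG-AGNOSTIC FORM (generic `d`, ratio `θ ∈ [0,1)`).**  For an in-block root `toSite rr`, a level `n`, a label `Y`: IF (REP)'s unrolled identity `hunroll` holds (p2 PART 5, verbatim) with level-0 term of label-weighted size `C₀` (`hΦ0`), and UNIFORMLY in the level `m < n`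
(`n = m + k + 1`, blocking `L = Lc^k`, level-free constants): (LAY) the level-`m` sandwich letter's super-block partial sum in units `S_m = unitS_{m+1} (Σ_{w ∈ box L} σ m
(L•Y + w))` is ff-valued (`hff`) with the slot-weighted profile `hS` (constant `Cs`, rate `m′ > κ`) under the face weight `hω` of the super-block of `Y`; and (LT) = THE LAYER
BOUND `hLT`: for `k ≥ 1`, the cubic push of `S_m` through the DRESSED chain `legChain (respStepBmSeq (toSite rr) Lc) (m+1) (k−1)` is `BiLoc … U U (K·θ^k·e^{−η‖Y−U‖₁}) (κ∕4)`
(supplied at `d = 3`, `θ = (√Lc)⁻¹` in the ENVELOPE reading by §3 `wLocStencil_unitS_three` below; for the literal dressed chain by leaf-01's K-LL-4 programme — OPEN) —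
THEN, at every slot `(κ′, u)`, `BiLoc (unitS_n (Φ n Y) κ′ u) u u ((C₀ + (K + 2(d+1)e^δ·Cs)·(1 − θ)⁻¹)·e^{−η‖Y−u‖₁}) (κ∕4)`, `η = min(κ∕2, δ∕2)`: the level-`n` Ward-locus remainder IN UNITS is bounded and
LABEL-LOCALISED, UNIFORMLY IN `n`.  Displayed, not discharged: (REP) `hunroll ∕ hΦ0`, (LAY) `hff ∕ hS ∕ hω`, (LT) `hLT`. -/
theorem wLocStencil_unitS_of_layer {d : ℕ} {rr : Fin (d + 1) → ℕ} (hrr : rr ∈ box (d + 1) Lc)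
    {Φ σ : ℕ → (Fin (d + 1) → ℤ) → Fin (d + 1) → (Fin (d + 1) → ℤ) → MKer (d + 1) (Fib d)} (n : ℕ) (Y : Fin (d + 1) → ℤ)
    {ω : ℕ → (Fin (d + 1) → ℤ) → ℝ} {Cs κ m' δ K C₀ θ : ℝ}
    (hκ : 0 < κ) (hm : κ < m') (hδ : 0 < δ) (hCs : 0 ≤ Cs) (hK : 0 ≤ K) (hθ0 : 0 ≤ θ) (hθ1 : θ < 1)
    (hunroll : Φ n Y =
      transport (fun j (S : Fin (d + 1) → (Fin (d + 1) → ℤ) → MKer (d + 1) (Fib d)) =>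
          fun κ' u' => ((Lc : ℝ) ^ (d + 1) * wE d Lc (j + 1)) • e3OfK Lc (coDressKBmAt (toSite rr) Lc (KInvStep (d := d) Lc j)) S κ' u') 0 n
          (∑ w ∈ box (d + 1) (Lc ^ n), Φ 0 (((Lc ^ n : ℕ) : ℤ) • Y + toSite w))
      + ∑ m ∈ Finset.range n,
          transport (fun j (S : Fin (d + 1) → (Fin (d + 1) → ℤ) → MKer (d + 1) (Fib d)) =>
              fun κ' u' => ((Lc : ℝ) ^ (d + 1) * wE d Lc (j + 1)) • e3OfK Lc (coDressKBmAt (toSite rr) Lc (KInvStep (d := d) Lc j)) S κ' u') (m + 1) (n - 1 - m)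
            (∑ w ∈ box (d + 1) (Lc ^ (n - 1 - m)), σ m (((Lc ^ (n - 1 - m) : ℕ) : ℤ) • Y + toSite w)))
    (hΦ0 : ∀ κ' u, BiLoc (transport (unitStepMap Lc (toSite rr) ((Lc : ℝ) ^ (d + 1))) 0 n
          (unitS (sfStep Lc 0) (smStep d Lc 0) (∑ w ∈ box (d + 1) (Lc ^ n), Φ 0 (((Lc ^ n : ℕ) : ℤ) • Y + toSite w))) κ' u) u u
          (C₀ * Real.exp (-(min (κ / 2) (δ / 2)) * l1 (Y - u))) (κ / 4))
    (hff : ∀ m k, m + k + 1 = n → ∀ κ' u, IsFF (unitS (sfStep Lc (m + 1)) (smStep d Lc (m + 1))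
        (∑ w ∈ box (d + 1) (Lc ^ k), σ m (((Lc ^ k : ℕ) : ℤ) • Y + toSite w)) κ' u))
    (hS : ∀ m k, m + k + 1 = n → ∀ k' u x z a b, |unitS (sfStep Lc (m + 1)) (smStep d Lc (m + 1))
        (∑ w ∈ box (d + 1) (Lc ^ k), σ m (((Lc ^ k : ℕ) : ℤ) • Y + toSite w)) k' u x z a b|
      ≤ Cs * ω m u * Real.exp (-m' * (l1 (x - u) + l1 (z - u))))
    (hω : ∀ m k, m + k + 1 = n → ∀ u, 0 ≤ ω m u ∧ ω m u ≤ ∑ μ : Fin (d + 1),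
      (∑ v ∈ ((box (d + 1) (Lc ^ k)).filter (fun v => v μ = Lc ^ k - 1)).image (fun v => ((Lc ^ k : ℕ) : ℤ) • Y + toSite v),
          Real.exp (-δ * l1 (v - u))
        + ∑ v ∈ ((box (d + 1) (Lc ^ k)).filter (fun v => v μ = 0)).image (fun v => ((Lc ^ k : ℕ) : ℤ) • Y + toSite v - unitVec μ),
            Real.exp (-δ * l1 (v - u))))
    (hLT : ∀ m k, m + k + 2 = n → ∀ ν U, BiLoc (((((Lc ^ (k + 1) : ℕ) : ℝ)) ^ (3 * (d + 1))) •
        push₃ (legChain (respStepBmSeq (toSite rr) Lc) (m + 1) k) (legChain (respStepBmSeq (toSite rr) Lc) (m + 1) k) (legChain (respStepBmSeq (toSite rr) Lc) (m + 1) k)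
          (unitS (sfStep Lc (m + 1)) (smStep d Lc (m + 1))
            (∑ w ∈ box (d + 1) (Lc ^ (k + 1)), σ m (((Lc ^ (k + 1) : ℕ) : ℤ) • Y + toSite w))) ν U) U U
        (K * θ ^ (k + 1) * Real.exp (-(min (κ / 2) (δ / 2)) * l1 (Y - U))) (κ / 4)) :
    ∀ κ' u, BiLoc (unitS (sfStep Lc n) (smStep d Lc n) (Φ n Y) κ' u) u u
      ((C₀ + (K + Cs * (((d : ℝ) + 1) * (2 * Real.exp δ))) * (1 - θ)⁻¹) * Real.exp (-(min (κ / 2) (δ / 2)) * l1 (Y - u))) (κ / 4) := by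
  have hηδ : min (κ / 2) (δ / 2) ≤ δ := (min_le_right _ _).trans (by linarith)
  have hK1 : 0 ≤ Cs * (((d : ℝ) + 1) * (2 * Real.exp δ)) := by positivity
  refine wLocStencil_unitS_of_unrolled (d := d) (fun _ u => Real.exp (-(min (κ / 2) (δ / 2)) * l1 (Y - u))) (fun _ u => (Real.exp_pos _).le)
    hθ0 hθ1 (add_nonneg hK hK1) (toSite rr) n Y hunroll hΦ0 ?_
  intro m hmr κ' u
  have he0 : 0 ≤ Real.exp (-(min (κ / 2) (δ / 2)) * l1 (Y - u)) := (Real.exp_pos _).le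
  obtain ⟨k, hk⟩ : ∃ k, n - 1 - m = k := ⟨_, rfl⟩
  rw [hk]
  rcases k with _ | k
  · -- the untransported level `m = n − 1`
    have hmk : m + 0 + 1 = n := by have := Finset.mem_range.1 hmr; omega
    have h := biLoc_of_profile_one hCs hδ.le hηδ (r := κ / 4) (by linarith) (hS m 0 hmk) (pow_zero Lc) Y (hω m 0 hmk) κ' u
    rw [transport_zero]
    refine biLoc_weaken h ?_ le_rfl
    show _ ≤ (K + Cs * (((d : ℝ) + 1) * (2 * Real.exp δ))) * θ ^ 0 * Real.exp (-(min (κ / 2) (δ / 2)) * l1 (Y - u))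
    rw [pow_zero, mul_one]
    nlinarith
  · -- `k + 1 ≥ 1` transported levels: ONE cubic push through the dressed chain, bounded by `hLT`
    have hmk : m + (k + 1) + 1 = n := by have := Finset.mem_range.1 hmr; omega
    have hmk2 : m + k + 2 = n := by omega
    have hSl := locStencil_of_profile hCs hδ.le (hS m (k + 1) hmk) Y (hω m (k + 1) hmk)
    have h := hLT m k hmk2 κ' u
    intro x z a b
    rw [transport_unitStepMap_eq_cubic_push₃ hrr (m + 1) k (hff m (k + 1) hmk) ⟨_, _, hκ.trans hm, hSl⟩ κ' u]
    refine (h x z a b).trans (mul_le_mul_of_nonneg_right ?_ (Real.exp_pos _).le)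
    show _ ≤ (K + Cs * (((d : ℝ) + 1) * (2 * Real.exp δ))) * θ ^ (k + 1) * Real.exp (-(min (κ / 2) (δ / 2)) * l1 (Y - u))
    have hθk : 0 ≤ θ ^ (k + 1) := pow_nonneg hθ0 _
    nlinarith [mul_nonneg (mul_nonneg hK1 hθk) he0]

/-! ## §2 The literal of record: the level-0 letter vanishes -/

/-- NOT IN PRINT; OUR BOOKKEEPING.  **THE LEG-AGNOSTIC END FOR THE LITERAL OF RECORD** (`Φ 0 ≡ 0`: an1 g57 `RB ≡ RB″ ≡ 0`, leaf-09 `RW ≡ RW″ ≡ 0`, p2 g37 W-R2 — every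
transported object is a sandwich letter; `WardRemainderRows.good_unitS_of_unrolled_zero`): §1 with `C₀ = 0` — the level-`n` remainder in units is
`BiLoc … u u ((K + 2(d+1)e^δ·Cs)·(1 − θ)⁻¹·e^{−η‖Y−u‖₁}) (κ∕4)`, uniformly in `n`, from (LAY) + (LT) alone. -/
theorem wLocStencil_unitS_of_layer_zero {d : ℕ} {rr : Fin (d + 1) → ℕ} (hrr : rr ∈ box (d + 1) Lc)
    {Φ σ : ℕ → (Fin (d + 1) → ℤ) → Fin (d + 1) → (Fin (d + 1) → ℤ) → MKer (d + 1) (Fib d)} (hΦ00 : ∀ y, Φ 0 y = 0) (n : ℕ) (Y : Fin (d + 1) → ℤ)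
    {ω : ℕ → (Fin (d + 1) → ℤ) → ℝ} {Cs κ m' δ K θ : ℝ}
    (hκ : 0 < κ) (hm : κ < m') (hδ : 0 < δ) (hCs : 0 ≤ Cs) (hK : 0 ≤ K) (hθ0 : 0 ≤ θ) (hθ1 : θ < 1)
    (hunroll : Φ n Y =
      transport (fun j (S : Fin (d + 1) → (Fin (d + 1) → ℤ) → MKer (d + 1) (Fib d)) =>
          fun κ' u' => ((Lc : ℝ) ^ (d + 1) * wE d Lc (j + 1)) • e3OfK Lc (coDressKBmAt (toSite rr) Lc (KInvStep (d := d) Lc j)) S κ' u') 0 n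
          (∑ w ∈ box (d + 1) (Lc ^ n), Φ 0 (((Lc ^ n : ℕ) : ℤ) • Y + toSite w))
      + ∑ m ∈ Finset.range n,
          transport (fun j (S : Fin (d + 1) → (Fin (d + 1) → ℤ) → MKer (d + 1) (Fib d)) =>
              fun κ' u' => ((Lc : ℝ) ^ (d + 1) * wE d Lc (j + 1)) • e3OfK Lc (coDressKBmAt (toSite rr) Lc (KInvStep (d := d) Lc j)) S κ' u') (m + 1) (n - 1 - m)
            (∑ w ∈ box (d + 1) (Lc ^ (n - 1 - m)), σ m (((Lc ^ (n - 1 - m) : ℕ) : ℤ) • Y + toSite w)))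
    (hff : ∀ m k, m + k + 1 = n → ∀ κ' u, IsFF (unitS (sfStep Lc (m + 1)) (smStep d Lc (m + 1))
        (∑ w ∈ box (d + 1) (Lc ^ k), σ m (((Lc ^ k : ℕ) : ℤ) • Y + toSite w)) κ' u))
    (hS : ∀ m k, m + k + 1 = n → ∀ k' u x z a b, |unitS (sfStep Lc (m + 1)) (smStep d Lc (m + 1))
        (∑ w ∈ box (d + 1) (Lc ^ k), σ m (((Lc ^ k : ℕ) : ℤ) • Y + toSite w)) k' u x z a b|
      ≤ Cs * ω m u * Real.exp (-m' * (l1 (x - u) + l1 (z - u))))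
    (hω : ∀ m k, m + k + 1 = n → ∀ u, 0 ≤ ω m u ∧ ω m u ≤ ∑ μ : Fin (d + 1),
      (∑ v ∈ ((box (d + 1) (Lc ^ k)).filter (fun v => v μ = Lc ^ k - 1)).image (fun v => ((Lc ^ k : ℕ) : ℤ) • Y + toSite v),
          Real.exp (-δ * l1 (v - u))
        + ∑ v ∈ ((box (d + 1) (Lc ^ k)).filter (fun v => v μ = 0)).image (fun v => ((Lc ^ k : ℕ) : ℤ) • Y + toSite v - unitVec μ),
            Real.exp (-δ * l1 (v - u))))
    (hLT : ∀ m k, m + k + 2 = n → ∀ ν U, BiLoc (((((Lc ^ (k + 1) : ℕ) : ℝ)) ^ (3 * (d + 1))) •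
        push₃ (legChain (respStepBmSeq (toSite rr) Lc) (m + 1) k) (legChain (respStepBmSeq (toSite rr) Lc) (m + 1) k) (legChain (respStepBmSeq (toSite rr) Lc) (m + 1) k)
          (unitS (sfStep Lc (m + 1)) (smStep d Lc (m + 1))
            (∑ w ∈ box (d + 1) (Lc ^ (k + 1)), σ m (((Lc ^ (k + 1) : ℕ) : ℤ) • Y + toSite w))) ν U) U U
        (K * θ ^ (k + 1) * Real.exp (-(min (κ / 2) (δ / 2)) * l1 (Y - U))) (κ / 4)) :
    ∀ κ' u, BiLoc (unitS (sfStep Lc n) (smStep d Lc n) (Φ n Y) κ' u) u u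
      ((K + Cs * (((d : ℝ) + 1) * (2 * Real.exp δ))) * (1 - θ)⁻¹ * Real.exp (-(min (κ / 2) (δ / 2)) * l1 (Y - u))) (κ / 4) := by
  have hsum0 : (∑ w ∈ box (d + 1) (Lc ^ n), Φ 0 (((Lc ^ n : ℕ) : ℤ) • Y + toSite w)) = 0 := Finset.sum_eq_zero fun w _ => hΦ00 _
  have hΦ0 : ∀ κ' u, BiLoc (transport (unitStepMap Lc (toSite rr) ((Lc : ℝ) ^ (d + 1))) 0 n
      (unitS (sfStep Lc 0) (smStep d Lc 0) (∑ w ∈ box (d + 1) (Lc ^ n), Φ 0 (((Lc ^ n : ℕ) : ℤ) • Y + toSite w))) κ' u) u u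
      (0 * Real.exp (-(min (κ / 2) (δ / 2)) * l1 (Y - u))) (κ / 4) := by
    intro κ' u x z a b
    rw [hsum0, unitS_zero, transport_unitStepMap_zero]
    simp
  have h := wLocStencil_unitS_of_layer hrr n Y hκ hm hδ hCs hK hθ0 hθ1 hunroll hΦ0 hff hS hω hLT
  simpa only [zero_add] using h

/-! ## §3 THE END IN THE ENVELOPE READING — the layer bound from leaf-01's (LT-3) END -/

/-- NOT IN PRINT; OUR BOOKKEEPING (§1 with `hLT := WardRemainderTransportedLetter.biLoc_cubic_push₃_dressed_three` = leaf-01 g64's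
`LayerTransportBiLoc.biLoc_cubic_push₃_layer_three_weight` (p324201 ✓) on the dressed chain).  **THE ASSEMBLY «(Q-R) AT `d = 3`» IN THE ENVELOPE READING**: the
layer bound `hLT` of §1 is supplied by leaf-01's (LT-3) END under ITS hypotheses, so the displayed rows become: K-LL-4 = the three ENVELOPES `hT0 ∕ hT1 ∕ hT2`
((N1)∕(N1′)∕Hölder with the `√L`) of the DRESSED composite legs `legChain (respStepBmSeq (toSite rr) Lc) (m+1) (k−1)` — HONEST: NOT expected pointwise for the
literal (leaf-01 g63 R-5: the dressed chain's gauge function jumps across block faces; RULING R-gan24p1-g26-2∕-3: the dressing is moved onto the letters — that route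
feeds §1's `hLT` directly, not this corollary); (LAY)∕(CE) `hff, hS, hω, hQ, hZ, hTl, hTcard`; (S) = (M0) ∧ (Π) `hM0 ∕ hP1` (or (INV) via §4); (REP) `hunroll ∕ hΦ0`.
Constant: `(C₀ + (K + 8e^δ·Cs)·(1 − (√Lc)⁻¹)⁻¹)·e^{−η‖Y−u‖₁}` with `K` leaf-01's explicit constant (`hCT : 0 ≤ CT` displayed for its sign). -/
theorem wLocStencil_unitS_three {rr : Fin (3 + 1) → ℕ} (hrr : rr ∈ box (3 + 1) Lc) (hLc : 2 ≤ Lc)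
    {Φ σ : ℕ → (Fin (3 + 1) → ℤ) → Fin (3 + 1) → (Fin (3 + 1) → ℤ) → MKer (3 + 1) (Fib 3)} (n : ℕ) (Y : Fin (3 + 1) → ℤ)
    {ω : ℕ → (Fin (3 + 1) → ℤ) → ℝ}
    {Z : ℕ → Fin (3 + 1) → Fin (3 + 1) → Fin (3 + 1) → (Fin (3 + 1) → ℤ) → (Fin (3 + 1) → ℤ) → ℝ} {Tl : ℕ → Finset (Fin (3 + 1) → ℤ)}
    {A A' A'' Cs κ m' δ B δZ ρ CT C₀ : ℝ}
    (hκ : 0 < κ) (hm : κ < m') (hδ : 0 < δ) (hA : 0 ≤ A) (hA' : 0 ≤ A') (hA'' : 0 ≤ A'') (hCs : 0 ≤ Cs) (hB : 0 ≤ B) (hκδZ : 4 * κ < δZ)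
    (hCT : 0 ≤ CT)
    (hunroll : Φ n Y =
      transport (fun j (S : Fin (3 + 1) → (Fin (3 + 1) → ℤ) → MKer (3 + 1) (Fib 3)) =>
          fun κ' u' => ((Lc : ℝ) ^ (3 + 1) * wE 3 Lc (j + 1)) • e3OfK Lc (coDressKBmAt (toSite rr) Lc (KInvStep (d := 3) Lc j)) S κ' u') 0 n
          (∑ w ∈ box (3 + 1) (Lc ^ n), Φ 0 (((Lc ^ n : ℕ) : ℤ) • Y + toSite w))
      + ∑ m ∈ Finset.range n,
          transport (fun j (S : Fin (3 + 1) → (Fin (3 + 1) → ℤ) → MKer (3 + 1) (Fib 3)) =>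
              fun κ' u' => ((Lc : ℝ) ^ (3 + 1) * wE 3 Lc (j + 1)) • e3OfK Lc (coDressKBmAt (toSite rr) Lc (KInvStep (d := 3) Lc j)) S κ' u') (m + 1) (n - 1 - m)
            (∑ w ∈ box (3 + 1) (Lc ^ (n - 1 - m)), σ m (((Lc ^ (n - 1 - m) : ℕ) : ℤ) • Y + toSite w)))
    (hΦ0 : ∀ κ' u, BiLoc (transport (unitStepMap Lc (toSite rr) ((Lc : ℝ) ^ (3 + 1))) 0 n
          (unitS (sfStep Lc 0) (smStep 3 Lc 0) (∑ w ∈ box (3 + 1) (Lc ^ n), Φ 0 (((Lc ^ n : ℕ) : ℤ) • Y + toSite w))) κ' u) u u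
          (C₀ * Real.exp (-(min (κ / 2) (δ / 2)) * l1 (Y - u))) (κ / 4))
    (hT0 : ∀ m k, m + k + 2 = n → ∀ α x' k' x, |legChain (respStepBmSeq (toSite rr) Lc) (m + 1) k α x' k' x|
      ≤ A * ((((Lc ^ (k + 1) : ℕ) : ℝ)) ^ (3 + 2))⁻¹ * Real.exp (-κ * l1 (quo (Lc ^ (k + 1)) x - x')))
    (hT1 : ∀ m k, m + k + 2 = n → ∀ α x' k' x i,
      |legChain (respStepBmSeq (toSite rr) Lc) (m + 1) k α x' k' (x + Pi.single i 1) - legChain (respStepBmSeq (toSite rr) Lc) (m + 1) k α x' k' x|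
      ≤ A' * ((((Lc ^ (k + 1) : ℕ) : ℝ)) ^ (3 + 3))⁻¹ * Real.exp (-κ * l1 (quo (Lc ^ (k + 1)) x - x')))
    (hT2 : ∀ m k, m + k + 2 = n → ∀ α x' k' x i j,
      |(legChain (respStepBmSeq (toSite rr) Lc) (m + 1) k α x' k' (x + Pi.single i 1 + Pi.single j 1)
        - legChain (respStepBmSeq (toSite rr) Lc) (m + 1) k α x' k' (x + Pi.single j 1))
        - (legChain (respStepBmSeq (toSite rr) Lc) (m + 1) k α x' k' (x + Pi.single i 1) - legChain (respStepBmSeq (toSite rr) Lc) (m + 1) k α x' k' x)|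
      ≤ A'' * ((((Lc ^ (k + 1) : ℕ) : ℝ)) ^ (3 + 3) * Real.sqrt (((Lc ^ (k + 1) : ℕ) : ℝ)))⁻¹ * Real.exp (-κ * l1 (quo (Lc ^ (k + 1)) x - x')))
    (hff : ∀ m k, m + k + 1 = n → ∀ κ' u, IsFF (unitS (sfStep Lc (m + 1)) (smStep 3 Lc (m + 1))
        (∑ w ∈ box (3 + 1) (Lc ^ k), σ m (((Lc ^ k : ℕ) : ℤ) • Y + toSite w)) κ' u))
    (hS : ∀ m k, m + k + 1 = n → ∀ k' u x z a b, |unitS (sfStep Lc (m + 1)) (smStep 3 Lc (m + 1))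
        (∑ w ∈ box (3 + 1) (Lc ^ k), σ m (((Lc ^ k : ℕ) : ℤ) • Y + toSite w)) k' u x z a b|
      ≤ Cs * ω m u * Real.exp (-m' * (l1 (x - u) + l1 (z - u))))
    (hω : ∀ m k, m + k + 1 = n → ∀ u, 0 ≤ ω m u ∧ ω m u ≤ ∑ μ : Fin (3 + 1),
      (∑ v ∈ ((box (3 + 1) (Lc ^ k)).filter (fun v => v μ = Lc ^ k - 1)).image (fun v => ((Lc ^ k : ℕ) : ℤ) • Y + toSite v),
          Real.exp (-δ * l1 (v - u))
        + ∑ v ∈ ((box (3 + 1) (Lc ^ k)).filter (fun v => v μ = 0)).image (fun v => ((Lc ^ k : ℕ) : ℤ) • Y + toSite v - unitVec μ),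
            Real.exp (-δ * l1 (v - u))))
    (hQ : ∀ m k, m + k + 1 = n → ∀ k' κ₁ κ₂ u, ∑' x, ∑' z, unitS (sfStep Lc (m + 1)) (smStep 3 Lc (m + 1))
        (∑ w ∈ box (3 + 1) (Lc ^ k), σ m (((Lc ^ k : ℕ) : ℤ) • Y + toSite w)) k' u x z (Sum.inl κ₁) (Sum.inl κ₂)
      = ∑ y' ∈ Tl m, Z m k' κ₁ κ₂ y' u)
    (hZ : ∀ m, m < n → ∀ k' κ₁ κ₂, ∀ y' ∈ Tl m, ∀ e, |Z m k' κ₁ κ₂ y' e| ≤ B * Real.exp (-δZ * l1 (e - y')))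
    (hM0 : ∀ m, m < n → ∀ k' κ₁ κ₂, ∀ y' ∈ Tl m, ∑' e, Z m k' κ₁ κ₂ y' e = 0)
    (hP1 : ∀ m, m < n → ∀ k' κ₁ κ₂, ∀ y' ∈ Tl m, ∀ i : Fin (3 + 1), ∑' e, (((e - y') i : ℤ) : ℝ) * Z m k' κ₁ κ₂ y' e = 0)
    (hTl : ∀ m k, m + k + 1 = n → ∀ y' ∈ Tl m, l1 (quo (Lc ^ k) y' - Y) ≤ ρ)
    (hTcard : ∀ m k, m + k + 1 = n → ((Tl m).card : ℝ) ≤ CT * (((Lc ^ k : ℕ) : ℝ)) ^ (3 + 1)) :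
    ∀ κ' u, BiLoc (unitS (sfStep Lc n) (smStep 3 Lc n) (Φ n Y) κ' u) u u
      ((C₀ + ((((((3 : ℝ) + 1) ^ 3 * A ^ 2 * A' * Cs * (2 / (m' - κ) * Zl (3 + 1) ((m' - κ) / 2)) * (Zl (3 + 1) (m' - κ) + Zl (3 + 1) m'))
            * ((2 * ((3 : ℝ) + 1)) ^ 2 * Zl (3 + 1) (δ / 2) * Real.exp (min (κ / 2) (δ / 2))))
        + ((3 : ℝ) + 1) ^ 3 *
          ((((A'' * A * A + 2 * A' * A' * A + A * A'' * A) * Real.exp (2 * κ) + 2 * ((A' * A + A * A') * Real.exp κ) * A' + A * A * A'')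
              * Real.exp (2 * (2 * κ))) * B * (8 / (δZ - 2 * (2 * κ)) ^ 2 * Zl (3 + 1) ((δZ - 2 * (2 * κ)) / 4)) * Real.exp ((κ / 2) * ρ) * CT))
          + Cs * (((3 : ℝ) + 1) * (2 * Real.exp δ))) * (1 - (Real.sqrt (Lc : ℝ))⁻¹)⁻¹) * Real.exp (-(min (κ / 2) (δ / 2)) * l1 (Y - u))) (κ / 4) := by
  have hmk' : 0 < m' - κ := sub_pos.2 hm
  have hc : 0 < δZ - 2 * (2 * κ) := by linarith
  have hZ1 : 0 ≤ Zl (3 + 1) ((m' - κ) / 2) := Zl_nonneg (half_pos hmk')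
  have hZ2 : 0 ≤ Zl (3 + 1) (m' - κ) := Zl_nonneg hmk'
  have hZ3 : 0 ≤ Zl (3 + 1) m' := Zl_nonneg (hκ.trans hm)
  have hZ4 : 0 ≤ Zl (3 + 1) (δ / 2) := Zl_nonneg (half_pos hδ)
  have hZ5 : 0 ≤ Zl (3 + 1) ((δZ - 2 * (2 * κ)) / 4) := Zl_nonneg (by positivity)
  have hK0 : 0 ≤ (((((3 : ℝ) + 1) ^ 3 * A ^ 2 * A' * Cs * (2 / (m' - κ) * Zl (3 + 1) ((m' - κ) / 2)) * (Zl (3 + 1) (m' - κ) + Zl (3 + 1) m'))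
            * ((2 * ((3 : ℝ) + 1)) ^ 2 * Zl (3 + 1) (δ / 2) * Real.exp (min (κ / 2) (δ / 2))))
        + ((3 : ℝ) + 1) ^ 3 *
          ((((A'' * A * A + 2 * A' * A' * A + A * A'' * A) * Real.exp (2 * κ) + 2 * ((A' * A + A * A') * Real.exp κ) * A' + A * A * A'')
              * Real.exp (2 * (2 * κ))) * B * (8 / (δZ - 2 * (2 * κ)) ^ 2 * Zl (3 + 1) ((δZ - 2 * (2 * κ)) / 4)) * Real.exp ((κ / 2) * ρ) * CT)) := by positivity
  -- the ratio `θ = (√Lc)⁻¹ ∈ [0, 1)` at `Lc ≥ 2`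
  have hLc1 : (1 : ℝ) < (Lc : ℝ) := by exact_mod_cast hLc
  have hs1 : 1 < Real.sqrt (Lc : ℝ) := by
    rw [show (1 : ℝ) = Real.sqrt 1 from Real.sqrt_one.symm]
    exact Real.sqrt_lt_sqrt zero_le_one hLc1
  have hθ0 : 0 ≤ (Real.sqrt (Lc : ℝ))⁻¹ := inv_nonneg.2 (Real.sqrt_nonneg _)
  have hθ1 : (Real.sqrt (Lc : ℝ))⁻¹ < 1 := inv_lt_one_of_one_lt₀ hs1
  have e3 : ((3 : ℕ) : ℝ) = (3 : ℝ) := by norm_num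
  have h := wLocStencil_unitS_of_layer hrr n Y hκ hm hδ hCs hK0 hθ0 hθ1 hunroll hΦ0 hff hS hω
    fun m k hmk ν U => biLoc_cubic_push₃_dressed_three rr (m + 1) k hκ hm hδ hA hA' hA'' hCs hB hκδZ (hT0 m k hmk) (hT1 m k hmk) (hT2 m k hmk)
      (hS m (k + 1) (by omega)) Y (hω m (k + 1) (by omega)) (hQ m (k + 1) (by omega)) (hZ m (by omega)) (hM0 m (by omega)) (hP1 m (by omega))
      (hTl m (k + 1) (by omega)) (hTcard m (k + 1) (by omega)) ν U
  rw [e3] at h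
  exact h

/-! ## §4 THE (S) ROW FROM (INV) ∧ (M0) — the owner's `SlotMomentParity` plugged into `hP1` -/

omit [NeZero Lc] in
/-- NOT IN PRINT; OUR BOOKKEEPING (RULING R-gan24p1-g27-1 A+B: the (S) row := (M0)_j ∧ (Π)_j per label; CONTENT = (INV), the slot involution
`σ_k : u ↦ 2•y′ − e_k − u` through the label `y′` of a profile in slot direction `k` — exact on ENGINE SDF-1 at D = 2 and D = 3 (E19∕E20), NOT a theorem
here; `SlotMomentParity.moments_of_slotInv`).  **`hP1` OF THE END FROM (INV) AND (M0)**: for label-decomposed charge profiles with the envelope `hZ`, zero mass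
`hM0` (W-Z0) and the slot-inversion covariance `hinv` ((INV), displayed), every first moment about the label vanishes — the `hP1` family of
`wLocStencil_unitS_three` verbatim (any `d`). -/
theorem firstMoments_of_slotInv {d n : ℕ}
    {Z : ℕ → Fin (d + 1) → Fin (d + 1) → Fin (d + 1) → (Fin (d + 1) → ℤ) → (Fin (d + 1) → ℤ) → ℝ} {Tl : ℕ → Finset (Fin (d + 1) → ℤ)} {B δZ : ℝ}
    (hδZ : 0 < δZ)
    (hZ : ∀ m, m < n → ∀ k' κ₁ κ₂, ∀ y' ∈ Tl m, ∀ e, |Z m k' κ₁ κ₂ y' e| ≤ B * Real.exp (-δZ * l1 (e - y')))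
    (hM0 : ∀ m, m < n → ∀ k' κ₁ κ₂, ∀ y' ∈ Tl m, ∑' e, Z m k' κ₁ κ₂ y' e = 0)
    (hinv : ∀ m, m < n → ∀ k' κ₁ κ₂, ∀ y' ∈ Tl m, ∀ e,
      Z m k' κ₁ κ₂ y' ((2 : ℕ) • y' - (Pi.single k' (1 : ℤ) : Fin (d + 1) → ℤ) - e) = Z m k' κ₁ κ₂ y' e) :
    ∀ m, m < n → ∀ k' κ₁ κ₂, ∀ y' ∈ Tl m, ∀ i : Fin (d + 1), ∑' e, (((e - y') i : ℤ) : ℝ) * Z m k' κ₁ κ₂ y' e = 0 :=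
  fun m hm k' κ₁ κ₂ y' hy' i => (moments_of_slotInv y' k' hδZ (hZ m hm k' κ₁ κ₂ y' hy') (hinv m hm k' κ₁ κ₂ y' hy') (hM0 m hm k' κ₁ κ₂ y' hy')).2 i

/-! ## §5 The literal's `hff`: super-block sums of sandwich letters are ff-valued (by name: `Push4.isFF_mmRead`, `SrecWilsonSector.isFF_smul ∕ isFF_unitS`) -/

omit [NeZero Lc] in
/-- [folklore] A finite sum of table families that are ff-valued slot by slot is ff-valued slot by slot. -/
theorem isFF_finset_sum_apply {d : ℕ} {ι : Type*} (s : Finset ι) {X : ι → Fin (d + 1) → (Fin (d + 1) → ℤ) → MKer (d + 1) (Fib d)}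
    (hX : ∀ i ∈ s, ∀ κ u, IsFF (X i κ u)) (κ : Fin (d + 1)) (u : Fin (d + 1) → ℤ) : IsFF ((∑ i ∈ s, X i) κ u) := by
  refine ⟨fun x z μ b => ?_, fun x z a ν => ?_⟩
  · rw [Finset.sum_apply, Finset.sum_apply, Finset.sum_apply, Finset.sum_apply, Finset.sum_apply, Finset.sum_apply]
    exact Finset.sum_eq_zero fun i hi => (hX i hi κ u).1 x z μ b
  · rw [Finset.sum_apply, Finset.sum_apply, Finset.sum_apply, Finset.sum_apply, Finset.sum_apply, Finset.sum_apply]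
    exact Finset.sum_eq_zero fun i hi => (hX i hi κ u).2 x z a ν

omit [NeZero Lc] in
/-- [folklore] The sandwich letter's slot value `c • Σ_v mmRead N (F v)` is ff-valued (p2 PART 5's `σ m Y′ κ′ u′ = (−(Lc^{d+1}·wE)) • Σ_{v∈box Lc} mmRead Lc (G_m ∘ Ψ m … ∘ G_m)`). -/
theorem isFF_smul_sum_mmRead {d : ℕ} {ι : Type*} (s : Finset ι) (c : ℝ) (N : ℕ) (F : ι → MKer (d + 1) (Fib d)) :
    IsFF (c • ∑ i ∈ s, mmRead N (F i)) := by
  refine isFF_smul ⟨fun x z μ b => ?_, fun x z a ν => ?_⟩ c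
  · rw [Finset.sum_apply, Finset.sum_apply, Finset.sum_apply, Finset.sum_apply]
    exact Finset.sum_eq_zero fun i _ => (isFF_mmRead N (F i)).1 x z μ b
  · rw [Finset.sum_apply, Finset.sum_apply, Finset.sum_apply, Finset.sum_apply]
    exact Finset.sum_eq_zero fun i _ => (isFF_mmRead N (F i)).2 x z a ν

omit [NeZero Lc] in
/-- NOT IN PRINT; OUR BOOKKEEPING.  **THE END's `hff` FOR THE LITERAL**: the unit-currency super-block partial sum `unitS sf sm (Σ_{w ∈ s} σ (… w))` of a letter family that is
ff-valued slot by slot (e.g. by `isFF_smul_sum_mmRead`) is ff-valued slot by slot — so `hff` of §1–§3 is discharged by name for p2's sandwich letters. -/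
theorem isFF_unitS_finset_sum {d : ℕ} {ι : Type*} (s : Finset ι) (sf sm : ℝ) {X : ι → Fin (d + 1) → (Fin (d + 1) → ℤ) → MKer (d + 1) (Fib d)}
    (hX : ∀ i ∈ s, ∀ κ u, IsFF (X i κ u)) (κ : Fin (d + 1)) (u : Fin (d + 1) → ℤ) : IsFF (unitS sf sm (∑ i ∈ s, X i) κ u) :=
  isFF_unitS (isFF_finset_sum_apply s hX) sf sm κ u

end Summit.QuantumFields.BalabanUV.Beta.GAN24.WardRemainderEndThree

end
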